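/-
Copyright: the b2b-balaban T⁴-continuum CRUX team, row NE7b leaf lineage `t4-ne7b-formalise-leaf-01` (gen 87). Project licence.
-/
import Summits.QuantumFields.BalabanUV.T4Continuum.Spine.NE7b.BlockSectionRowSumKernel

/-!
# EXPONENTIAL DECAY OF THE SIDE-2 ONE-SHOT SECTION ON `ℤ⁴`, BY VALUE, AT FULL KERNEL WEIGHT:
# `|H(p, y)| ≤ (436∕10⁵)·(5∕7)^{|blk p − y|₁}` for every block `y` at sup-distance `≥ 5` from `blk p` (every `a > 0`; axioms = the trio)
# (row NE7b, node U5c; the POINTWISE letter of this lineage's `BlockSectionAgmonLetter` read on CERT-1's competitor with the kernel-evaluated residual of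
# `BlockSectionRowSumKernel{Facts,}` — rate `log(7∕5) ≈ 0.336` per block in `ℓ¹`, prefactor `C_N∕(5²⁰·2⁴⁸)·(35∕62) = 0.004353…`; [folklore] + kernel computation)

Cell `pub-balaban`, sub-cell `t4`, spine estimate NE7b (`T4WeightBudget.RelWeightBound`; the cell's OWN estimate — NOT PRINTED in [Bałaban 1983–89], NOT
PROVED).  Crux-route work under `Spine/NE7b/` by a row leaf (`t4-ne7b-formalise-leaf-01` gen 87) under FREEZE (0)'s crux-prover clause; NOTHING of Bałaban's
is named as a Lean object, valued or asserted; no `T4Continuum/Support` leaf typed; no `def`; zero `sorry`; NO `native_decide` (the residual number is file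
3∕4's `S2num_le`, evaluated by the kernel).  Imports: `BlockSectionRowSumKernel` (file 4∕4: the competitor `φ = phiZ∕2⁴⁴`, `phi_support`, `blockSums_phi`,
`residual_support`, `residualNorm_eq`, `S2Q_eq`; through it `BlockSectionAgmonLetter.abs_kerH_sub_le`, `BlockSectionRowSumCertificate`'s weight lemmas,
`HypercubeBlockGap.blockGap_two`, `B5Hk165TranslZd.kerH_eq_col_zero`).

WHY.  The row-sum number (`Σ_y |H(p,y)| ≤ 2.587`, BSRK) prices the MASS of a row; the sup road's next junction (OWNER g115 (62) `OneShotChartWeightedRows`,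
refuter v132 F784 (a): «kernel DECAY is load-bearing») prices its DECAY, with symbolic rates.  The same certificate gives decay BY VALUE for free: the Agmon
letter's pointwise form `|H(q,0) − φ(q)| ≤ w(blk q)⁻¹·‖w·P(−Δ)φ‖₂∕m` with the weight `w = (7∕5)^{min(|·|₁, T)}` (truncated high enough to read untruncated on
the residual window and at `blk q`), `m = 62∕35`, and the kernel's `‖w·P(−Δ)φ‖₂ ≤ C_N∕(5²⁰·2⁴⁸)` (`C_N = 206992365267364500521373518`, `S2num_le`); off the
competitor's support (`|blk p − y|_∞ ≥ 5`) `φ = 0` and translation covariance moves `(p, y)` to `(p − 2y, 0)`.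

WHAT IS PROVED (d = 4, side 2, every `a > 0`; [folklore] + kernel computation, axioms ⊆ {propext, Classical.choice, Quot.sound}):
* `natAbs_sum_le_twenty` (blocks of the residual window have `|·|₁ ≤ 20`), `phi_eq_zero_of_far` (the competitor vanishes `≥ 5` blocks away in sup distance).
* **`abs_kerH_col_zero_sub_phi_le`**: `|kerH 1 a q 0 − φ q| ≤ (5∕7)^{|blk q|₁} · (C_N∕(5²⁰·2⁴⁸))∕(62∕35)` for EVERY `q` (inside the support it bounds the distance to
  the tabulated competitor).
* **`abs_kerH_le_of_far`**: `(∃ μ, 5 ≤ |blk 1 p μ − y μ|) → |kerH 1 a p y| ≤ 436∕100000 · (5∕7)^{Σ_μ |blk 1 p μ − y μ|}`.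

HONEST: [folklore] + kernel computation; a by-value decay letter of the FREE scalar side-2 block-mean skeleton on `ℤ⁴` — NOT Bałaban's estimate, and not
the symbolic-rate letters of (46)–(48)∕(62) (it instantiates their shape at one side with numbers); nothing of (A3) ∕ NC-NE7b-α; BY-NAME EFFECT ON THE WALL: NONE.
NE7b NOT PRINTED ∕ NOT PROVED; spine PROVED 0∕9; rung (B)+1 on a FINITE torus — NOT infinite volume, NOT the mass gap, NOT Clay.  HONEST DEPENDENCY: continuum
YM on T⁴ ⇐ BetaPertH ∧ nine spine estimates (0∕9 proved); BetaPertH ⇐ (D1) ∧ (D4) ∧ CAP+tail; G-an2-4 gates asym, D1 and NE2∕3∕4.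
-/

set_option autoImplicit false

namespace Summit.QuantumFields.BalabanUV.T4Continuum.NE7b.BlockSectionDecaySideTwo

open Finset
open Literature.MathematicalPhysics.QuantumFieldTheory.Balaban1983to89
open B6QGQLower276 (X B e blk loc side mem_B mem_U U side_mul_blk_add_loc loc_nonneg loc_le)
open B5Hk103ScalarZd (kerH)
open B5Hk103Unique (lapRow)
open B5Hk165TranslZd (bshift kerH_eq_col_zero)
open Summit.QuantumFields.BalabanUV.T4Continuum.NE7b.BlockSectionAgmonEngine (blk_sub_bshift)
open Summit.QuantumFields.BalabanUV.T4Continuum.NE7b.BlockSectionAgmonLetter (abs_kerH_sub_le)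
open Summit.QuantumFields.BalabanUV.T4Continuum.NE7b.BlockSectionRowSumCertificate (weight_pos weight_le weight_ratio_le pow_min_ratio_le)
open Summit.QuantumFields.BalabanUV.T4Continuum.NE7b.HypercubeBlockGap (blockGap_two)
open Summit.QuantumFields.BalabanUV.T4Continuum.NE7b.BlockSectionRowSumValue (rng mem_rng Sbox boxT)
open Summit.QuantumFields.BalabanUV.T4Continuum.NE7b.BlockSectionRowSumKernelData (phiZ phi S2Q S2num)
open Summit.QuantumFields.BalabanUV.T4Continuum.NE7b.BlockSectionRowSumKernelFacts (phiZ_eq_zero S2num_le)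
open Summit.QuantumFields.BalabanUV.T4Continuum.NE7b.BlockSectionRowSumKernel (phi_support blockSums_phi residual_support residualNorm_eq S2Q_eq)

/-- Blocks of the residual window `[−5, 5]⁴` have `|·|₁ ≤ 20`. [folklore] -/
theorem natAbs_sum_le_twenty {b : X 4} (hb : b ∈ boxT) : ∑ μ, (b μ).natAbs ≤ 20 := by
  rw [boxT, Fintype.mem_piFinset] at hb
  have h : ∀ μ : Fin 4, (b μ).natAbs ≤ 5 := fun μ => by have := mem_rng.1 (hb μ); omega
  calc ∑ μ, (b μ).natAbs ≤ ∑ _μ : Fin 4, 5 := Finset.sum_le_sum fun μ _ => h μ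
    _ = 20 := by simp

/-- The competitor vanishes at `p − 2y` as soon as `y` is `≥ 5` blocks away from `blk p` in some coordinate. [folklore] -/
theorem phi_eq_zero_of_far (p y : X 4) (hfar : ∃ μ : Fin 4, 5 ≤ |blk 1 p μ - y μ|) : phi (p - bshift 1 y) = 0 := by
  obtain ⟨μ, hμ⟩ := hfar
  have hs : side 1 = 2 := by simp [side]
  have hp : side 1 * blk 1 p μ + loc 1 p μ = p μ := side_mul_blk_add_loc 1 p μ
  rw [hs] at hp
  have hl0 : 0 ≤ loc 1 p μ := loc_nonneg 1 p μ
  have hl1 : loc 1 p μ ≤ 1 := by have := loc_le 1 p μ; exact_mod_cast this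
  have hq : (p - bshift 1 y) μ = p μ - 2 * y μ := by simp [bshift, two_mul]
  have hout : ¬ (∀ ν : Fin 4, -8 ≤ (p - bshift 1 y) ν ∧ (p - bshift 1 y) ν ≤ 9) := by
    intro hall
    have h := hall μ
    rw [hq] at h
    rcases le_abs.1 hμ with h5 | h5 <;> omega
  simp [phi, phiZ_eq_zero hout]

-- The `constructorNameAsVariable` linter puts binder types in weak head normal form; on the `have`s below (windows `U 1 boxT`, the weight family, the
-- kernel's residual number) that normalisation exhausts the recursion depth (tree precedent ×11: the linter, not the proof, is switched off on this decl).
set_option linter.constructorNameAsVariable false in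
/-- **THE POINTWISE LETTER BY VALUE**: for every fine site `q`,
`|kerH 1 a q 0 − φ q| ≤ (5∕7)^{|blk 1 q|₁} · (C_N∕(5²⁰·2⁴⁸))∕(62∕35)` — the Agmon letter `abs_kerH_sub_le` with the weight `(7∕5)^{min(|·|₁, T)}`,
`T := max(|blk q|₁, 20)`, the side-2 gap `2`, and the kernel's residual number. [folklore + kernel computation] -/
theorem abs_kerH_col_zero_sub_phi_le {a : ℝ} (ha : 0 < a) (q : X 4) :
    |kerH 1 a q 0 - phi q| ≤ ((5 : ℝ) / 7) ^ (∑ μ, ((blk 1 q) μ).natAbs) *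
      ((206992365267364500521373518 / ((5 : ℝ) ^ 20 * 2 ^ 48)) / (62 / 35)) := by
  classical
  set t : ℝ := 7 / 5 with ht
  have ht0 : (0 : ℝ) < t := by norm_num [ht]
  have ht1 : (1 : ℝ) ≤ t := by norm_num [ht]
  set Tc : ℕ := max (∑ μ, ((blk 1 q) μ).natAbs) 20 with hTc
  set w : X 4 → ℝ := fun z => t ^ min (∑ μ, (z μ).natAbs) Tc with hw
  -- the letter's statements carry `((1 : ℕ) + 1 : ℝ)`; normalise ours to that shape
  have hφ' : ∀ y : X 4, ∑ r ∈ B 1 y, phi r = (((1 : ℕ) : ℝ) + 1) ^ 4 * (if y = 0 then 1 else 0) := fun y => by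
    rw [blockSums_phi y]; norm_num
  have hT' : ∀ r ∉ U 1 boxT, lapRow phi r - ((((1 : ℕ) : ℝ) + 1) ^ 4)⁻¹ * ∑ s ∈ B 1 (blk 1 r), lapRow phi s = 0 := fun r hr => by
    have h := residual_support r hr; norm_num at h ⊢; exact h
  have hη : (0 : ℝ) ≤ (t + t⁻¹) / 2 - 1 := by norm_num [ht]
  have hm : (0 : ℝ) < 2 - (4 : ℕ) * ((t + t⁻¹) / 2 - 1) := by norm_num [ht]
  have h := abs_kerH_sub_le 1 le_rfl ha phi Sbox phi_support hφ' (U 1 boxT) hT' w ((t + t⁻¹) / 2 - 1) (t ^ Tc)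
    (fun z => weight_pos ht0 Tc z) (fun z => weight_le ht1 Tc z) hη (fun z μ => weight_ratio_le ht0 Tc z μ) 2 hm
    (fun y u hu => blockGap_two y u hu) q
  -- the weight at `blk q` reads untruncated
  have hwq : w (blk 1 q) = t ^ (∑ μ, ((blk 1 q) μ).natAbs) := by
    simp only [hw]; rw [min_eq_left (le_max_left _ _)]
  -- the weighted residual sum reads untruncated on the window and is the kernel's number
  have hres : ∑ r ∈ U 1 boxT, (w (blk 1 r) * (lapRow phi r - ((((1 : ℕ) : ℝ) + 1) ^ 4)⁻¹ * ∑ s ∈ B 1 (blk 1 r), lapRow phi s)) ^ 2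
      = (S2Q : ℝ) / 2 ^ 96 := by
    rw [← residualNorm_eq]
    refine Finset.sum_congr rfl fun r hr => ?_
    have hb : blk 1 r ∈ boxT := by rw [mem_U] at hr; exact hr
    have hwr : w (blk 1 r) = t ^ (∑ μ, ((blk 1 r) μ).natAbs) := by
      simp only [hw]; rw [min_eq_left ((natAbs_sum_le_twenty hb).trans (le_max_right _ _))]
    rw [hwr, ht]; norm_num
  have hS2 : (S2Q : ℝ) / 2 ^ 96 ≤ (206992365267364500521373518 / ((5 : ℝ) ^ 20 * 2 ^ 48)) ^ 2 := by
    have h1 : (S2Q : ℝ) = ((S2num : ℚ) : ℝ) / (5 : ℝ) ^ 40 := by rw [S2Q_eq]; push_cast; rfl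
    have h2 : ((S2num : ℚ) : ℝ) ≤ (206992365267364500521373518 : ℝ) ^ 2 := by exact_mod_cast S2num_le
    rw [h1]
    calc ((S2num : ℚ) : ℝ) / (5 : ℝ) ^ 40 / 2 ^ 96 ≤ (206992365267364500521373518 : ℝ) ^ 2 / (5 : ℝ) ^ 40 / 2 ^ 96 := by gcongr
      _ = (206992365267364500521373518 / ((5 : ℝ) ^ 20 * 2 ^ 48)) ^ 2 := by ring
  have hsqrt : Real.sqrt (∑ r ∈ U 1 boxT, (w (blk 1 r) * (lapRow phi r - ((((1 : ℕ) : ℝ) + 1) ^ 4)⁻¹ *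
      ∑ s ∈ B 1 (blk 1 r), lapRow phi s)) ^ 2) ≤ 206992365267364500521373518 / ((5 : ℝ) ^ 20 * 2 ^ 48) := by
    rw [hres, ← Real.sqrt_sq (by positivity : (0 : ℝ) ≤ 206992365267364500521373518 / ((5 : ℝ) ^ 20 * 2 ^ 48))]
    exact Real.sqrt_le_sqrt hS2
  have hmval : (2 : ℝ) - (4 : ℕ) * ((t + t⁻¹) / 2 - 1) = 62 / 35 := by norm_num [ht]
  rw [hwq, hmval] at h
  have hinv : (t ^ (∑ μ, ((blk 1 q) μ).natAbs))⁻¹ = ((5 : ℝ) / 7) ^ (∑ μ, ((blk 1 q) μ).natAbs) := by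
    rw [ht, ← inv_pow]; norm_num
  rw [hinv] at h
  refine h.trans ?_
  have hpos : (0 : ℝ) ≤ ((5 : ℝ) / 7) ^ (∑ μ, ((blk 1 q) μ).natAbs) := by positivity
  exact mul_le_mul_of_nonneg_left (div_le_div_of_nonneg_right hsqrt (by norm_num)) hpos

/-- **EXPONENTIAL DECAY BY VALUE**: if the block `y` is at sup-distance `≥ 5` from `blk p` then
`|kerH 1 a p y| ≤ (436∕100000)·(5∕7)^{|blk 1 p − y|₁}` — rate `log(7∕5)` per block in `ℓ¹` distance, every `a > 0`, axioms = the trio.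
[folklore + kernel computation] -/
theorem abs_kerH_le_of_far {a : ℝ} (ha : 0 < a) (p y : X 4) (hfar : ∃ μ : Fin 4, 5 ≤ |blk 1 p μ - y μ|) :
    |kerH 1 a p y| ≤ 436 / 100000 * ((5 : ℝ) / 7) ^ (∑ μ, (blk 1 p μ - y μ).natAbs) := by
  rw [kerH_eq_col_zero 1 ha p y]
  have h := abs_kerH_col_zero_sub_phi_le ha (p - bshift 1 y)
  rw [phi_eq_zero_of_far p y hfar, sub_zero, blk_sub_bshift] at h
  have hb : ∀ μ : Fin 4, (blk 1 p - y) μ = blk 1 p μ - y μ := fun μ => rfl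
  simp only [hb] at h
  refine h.trans ?_
  rw [mul_comm]
  have hpos : (0 : ℝ) ≤ ((5 : ℝ) / 7) ^ (∑ μ, (blk 1 p μ - y μ).natAbs) := by positivity
  exact mul_le_mul_of_nonneg_right (by norm_num) hpos

/-- Toy: five blocks away along one axis the bound is `436∕10⁵·(5∕7)⁵ < 8.2·10⁻⁴`; along the diagonal (`|·|₁ = 20`) it is `< 5.3·10⁻⁶`. -/
example : (436 : ℝ) / 100000 * ((5 : ℝ) / 7) ^ 5 < 82 / 100000 ∧ (436 : ℝ) / 100000 * ((5 : ℝ) / 7) ^ 20 < 53 / 10000000 := by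
  constructor <;> norm_num

end Summit.QuantumFields.BalabanUV.T4Continuum.NE7b.BlockSectionDecaySideTwo
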